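import Summits.RiemannHypothesis.RiemannHypothesis.Theorems.WeilGroundStateArchimedeanWindowSimpleEvenGapDefs
import HarnessLib

/-!
# `ArchimedeanWindowSimpleEven` — kernel check of the second half of the moment table (`N < q ≤ 2N`)

`checkNuB_weilGapCert`: the corresponding part of the gap checker `WeilGapCert.checkG` passes on the data
`weilGapCert`, evaluated by `decide +kernel` (one to three minutes of kernel time; kept in its own
file, as the tree's `WeilPositivityCertificateBlock0/1.lean`).

Route `RiemannHypothesis/WeilGroundState`, item `ArchimedeanWindowSimpleEven` (stmt-RiemannHypothesis-1529).
See `WeilGroundStateArchimedeanWindowSimpleEvenGapDefs.lean` for the certificate format, the data and the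
overall plan (LOWER bounds by the gap certificate `weilGapCert`, UPPER bound `ε((log 2)/2) ≤ 3/200` by the
trial function `trialFun`).
-/

namespace Summit.RiemannHypothesis.RiemannHypothesis.Theorems.WeilGroundState

open Literature.NumberTheory.LFunctions

set_option maxHeartbeats 0 in
/-- **Kernel check**: `weilGapCert.checkNuB = true`. [folklore] -/
theorem checkNuB_weilGapCert : weilGapCert.checkNuB = true := by
  decide +kernel

end Summit.RiemannHypothesis.RiemannHypothesis.Theorems.WeilGroundState
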